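import Summits.QuantumAdvantage.QuantumAdvantage.Theorems.CubicForrelationNearExactIsExactMismatchBudget
import Summits.QuantumAdvantage.QuantumAdvantage.Theorems.CubicForrelationNearExactIsExactFlatPartitionDistance

/-!
# Crux `CubicForrelation.NearExactIsExact` (stmt-QuantumAdvantage-14043), line `direct-sum-amplification`, lead c6 cycle 2:
  SOUNDNESS of the f-side certificates of the `n = 10` census

`partner_le_of_flatCertificate`: let `g₁` on 10 bits have the window Walsh structure relative to the last coordinate — `W_{g₁} = 32 p`
(`p` odd) on the hyperplane `{x₉ = bh}` and `W_{g₁} = 16 v` (`v` odd) on its complement — and let `t x := [p x < 0]` be the heavy sign word.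
If `𝔽₂⁹` contains 32 four-cubes, point-distinct across cubes, on each of which `t` has ODD parity (a *flat-partition certificate*), then NO cubic
`f₁` has `Φ(f₁, g₁) > 7/8`: by `stub_mismatchBudget` such an `f₁` disagrees with the Walsh signs on at most 31 heavy points, while by
`stub_flatPartitionDistance` (cubics are even on 4-cubes, `stub_cubicEvenOnFourFlat`) every 9-variable cubic differs from `t` in at least 32
points.  This is what makes the census's f-side Lean-grounded: for every g-side solution a certificate is found by randomised search and
checked by a 40-line independent verifier (evidence `UnbalancedCensus.md`).  Axioms: the standard three.
-/

set_option linter.dupNamespace false -- D-0017: single-problem summit ⇒ `QuantumAdvantage.QuantumAdvantage` by design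

noncomputable section

namespace Summit.QuantumAdvantage.QuantumAdvantage.Theorems.CubicForrelation.NearExactIsExact

open Finset
open Literature.Computability.QuantumComplexity
open Literature.Computability.QuantumComplexity.DerivativeWalsh (W)

/-- A sign mismatch in the heavy word: if `F x ≠ [p x < 0]` and `p x` is odd then `signOf (F x) · p x < 0`. -/
theorem fcs_mismatch_of_ne (F : Bool) (p : ℤ) (hp : Odd p) (h : F ≠ decide (p < 0)) :
    signOf F * (p : ℝ) < 0 := by
  have hp0 : p ≠ 0 := fun h0 => by rw [h0] at hp; exact (by decide : ¬ Odd (0 : ℤ)) hp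
  cases F
  · have : ¬ ¬ (p < 0) := fun hn => h (by rw [decide_eq_false hn])
    have hlt : p < 0 := not_not.1 this
    have : (p : ℝ) < 0 := by exact_mod_cast hlt
    rw [show signOf false = 1 from by simp [signOf]]; linarith
  · have : ¬ (p < 0) := fun hl => h (by rw [decide_eq_true hl])
    have hgt : 0 < p := lt_of_le_of_ne (not_lt.1 this) (Ne.symm hp0)
    have : (0 : ℝ) < p := by exact_mod_cast hgt
    rw [show signOf true = -1 from by simp [signOf]]; linarith

/-- **Soundness of the flat-partition certificate.** Window Walsh structure of `g₁` relative to the last coordinate (`32·odd` on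
`{x₉ = bh}`, `16·odd` off it) plus 32 point-distinct four-cubes on each of which the heavy sign word `[p < 0]` has odd parity force
`Φ(f₁, g₁) ≤ 7/8` for every cubic `f₁`. [lead c6 cycle 2; `stub_mismatchBudget` + `stub_flatPartitionDistance`] -/
theorem partner_le_of_flatCertificate :
    ∀ (f₁ g₁ : (Fin (4 + 4 + 1 + 1) → Bool) → Bool) (p v : (Fin (4 + 4 + 1) → Bool) → ℤ) (bh : Bool)
      (b : Fin 32 → Fin (4 + 4 + 1) → Bool) (u : Fin 32 → Fin 4 → Fin (4 + 4 + 1) → Bool),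
      IsDegLeFun 3 f₁ →
      (∀ x, W (fun y => signOf (g₁ y)) (Fin.snoc x bh) = 32 * (p x : ℝ)) → (∀ x, Odd (p x)) →
      (∀ x, W (fun y => signOf (g₁ y)) (Fin.snoc x (!bh)) = 16 * (v x : ℝ)) → (∀ x, Odd (v x)) →
      (∀ (k k' : Fin 32) (ε ε' : Fin 4 → Bool),
        (fun j => b k j ^^ ((ε 0 && u k 0 j) ^^ (ε 1 && u k 1 j) ^^ (ε 2 && u k 2 j) ^^ (ε 3 && u k 3 j))) =
          (fun j => b k' j ^^ ((ε' 0 && u k' 0 j) ^^ (ε' 1 && u k' 1 j) ^^ (ε' 2 && u k' 2 j) ^^ (ε' 3 && u k' 3 j))) → k = k') →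
      (∀ k : Fin 32, Odd ((univ.filter fun ε : Fin 4 → Bool =>
        decide (p (fun j => b k j ^^ ((ε 0 && u k 0 j) ^^ (ε 1 && u k 1 j) ^^ (ε 2 && u k 2 j) ^^ (ε 3 && u k 3 j))) < 0) = true).card)) →
      forrelation f₁ g₁ ≤ 7 / 8 := by
  intro f₁ g₁ p v bh b u hf₁ hWh hp hWl hv hdist hodd
  by_contra hgt
  push Not at hgt
  have hbud := stub_mismatchBudget f₁ g₁ p v bh hgt hWh hp hWl hv
  -- the heavy slice of `f₁` is a cubic on 9 bits
  have hF : IsDegLeFun 3 (fun x : Fin (4 + 4 + 1) → Bool => f₁ (Fin.snoc x bh)) := tb_isDegLeFun_snoc (F := f₁) hf₁ bh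
  have h32 := stub_flatPartitionDistance (fun x => f₁ (Fin.snoc x bh)) (fun x => decide (p x < 0)) b u hF hdist hodd
  -- every disagreement with the sign word is a heavy mismatch
  have hsub : (univ.filter fun x : Fin (4 + 4 + 1) → Bool => f₁ (Fin.snoc x bh) ≠ decide (p x < 0)) ⊆
      (univ.filter fun x : Fin (4 + 4 + 1) → Bool => signOf (f₁ (Fin.snoc x bh)) * (p x : ℝ) < 0) := by
    intro x hx
    rw [mem_filter] at hx ⊢
    exact ⟨hx.1, fcs_mismatch_of_ne _ _ (hp x) hx.2⟩
  have hcard := card_le_card hsub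
  have h32' : (32 : ℝ) ≤ ((univ.filter fun x : Fin (4 + 4 + 1) → Bool => signOf (f₁ (Fin.snoc x bh)) * (p x : ℝ) < 0).card : ℝ) := by
    exact_mod_cast h32.trans hcard
  have hnn : (0 : ℝ) ≤ ((univ.filter fun x : Fin (4 + 4 + 1) → Bool => signOf (f₁ (Fin.snoc x (!bh))) * (v x : ℝ) < 0).card : ℝ) :=
    Nat.cast_nonneg _
  linarith

end Summit.QuantumAdvantage.QuantumAdvantage.Theorems.CubicForrelation.NearExactIsExact
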